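/-
Copyright: cell `langlands-arthur-audit` (papers/Langlands/langlands-arthur-audit), unit `pub-arthur-typer-g7`
(LEAN TYPER gen 7, 2026-08-18).  Staged for the tree under `Literature/NumberTheory/Automorphic/Arthur2013/Leaves/`
(LEAN-IN-TREE rule 2026-08-18); imports `Mathlib` (list lemmas only: `List.map_get_finRange`, `List.ext_getElem`)
and `Leaves.Intertwining` (M27, §11: `EndoData`, `ECR2`, `ECR2viaPackets`, `LeviData`, `ALIR`, `HypArthurC`,
`AGIKMS.ThmD21C`).  Module map: M31.
-/
import Mathlib
import Literature.NumberTheory.Automorphic.Arthur2013.Leaves.Intertwining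

/-!
# Arthur (2013) audit, typed leaves — §17 the endoscopic groups `G_±` of (ECR2) COMPUTED from `(G, dim ψ_±)`; the supplementary assumptions of [AGIKMS] Thm D.2.1 NAMED; [AGIKMS] Hypothesis `ECR` and [Ar, Prop. 7.4.1] = [Mok] Prop. 8.4.1 (cell GAPS G-TY-5-3 (c), (e); DIVERGENCE D-UP-15)

§11 (`Leaves/Intertwining.lean`) types (ECR2) and (A-LIR) over the uninterpreted signature `EndoData` — the
two factors `G_+ = G′₁`, `G_- = G′₂` of the elliptic endoscopic group attached to `(G, ψ, x ∈ A_ψ)` are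
ARBITRARY scopes `e₁ s ψ x`, `e₂ s ψ x` (cell DIVERGENCE D-TY-35; GAPS G-TY-5-3 (c): "`EndoData` does not compute
G_± from (G, ψ_±)").  §17.1 computes them as far as the cell's tags allow.  [AGIKMS] (`note30.tex:L1514–L1515`,
VERBATIM): "Fix a conjugate-self-dual character $\eta_\pm$ of $E^\times$ such that there is a classical group
$G_\pm$ satisfying that $\psi_\pm \otimes \eta_\pm \in \Psi(G_\pm)$." — and WHICH classical group has
`Ψ(G_κ) ∋ ψ_κ ⊗ η_κ` is decided by `N = dim`, the sign and the determinant (`L1328–L1360`, quoted under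
`ClassicalType.endoFactor`): for `G = SO_{2n+1}` the factors are `SO_{m+1}`, `m = dim ψ_κ` even; for
`G = Sp_{2n}` and for [AGIKMS]'s `G = O_{2n}` they are `Sp_{m-1}` when `m` is odd (then "we must take
$\eta_{\kappa} = \det(\psi_\kappa)$", Rem. 1.6.1 = `rem.ECR` (3), `L1563–L1564`) and `O_m^{η′}` when `m` is even
(the table `L14142–L14154`: "\Sp_{2n_1}(F) \times \SO_{2n_2}^{\eta}(F) \iif G(F) = \Sp_{2n}(F)"); for `G = U_n`
they are `U_m` ([Mok] `main.tex:L774`: "(G^{\prime},\xi^{\prime}) = (U_{E/F}(N_1) \times U_{E/F}(N_2),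
\zeta_{\underline{\chi}})", `L777`: "N= N_1 + N_2").  This is the Boolean relation
`ClassicalType.endoFactor G m t` (family of `t` as a function of the family of `G` and the parity of `m`, and
`dim St_{t̂} = m`), imposed on an `EndoData` by `EndoData.Interprets` with `m = dim ψ_+` resp. `dim ψ_-`
(`ParamShape.dimPlus/dimMinus`, the dimensions of §11's `corestrict` / `restrict`; `dimPlus_add_dimMinus :
dim ψ_+ + dim ψ_- = dim ψ`, proved).  The KERNEL then sees: (`HypArthurC.endoscopic`) the second bullet of
[AGIKMS] Hypothesis 1.10.4 = `hyp.arthur` ("all $A$-parameters for $G'$ with $G'$ any classical group such that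
$\dim(\St_{\widehat{G'}}) < \dim(\St_{\widehat{G}})$", typed in §11 as clause 3 of `HypArthurC` through
`ClassicalType.stdDim`) supplies (ECR1), (ECR2) and (A-LIR) at the two factor scopes — i.e. for exactly the
packets `Π_{ψ_± ⊗ η_±}` that [AGIKMS]'s DEFINITION of `f′_G(ψ, s)` (§11 `ECR2viaPackets`) consumes — whenever
`s` is proper (`ψ_+ ≠ 0 ≠ ψ_-`) and `dim ψ = dim St_Ĝ` (`ShapeData.DimSound`, [AGIKMS] `L1331` with `L1343`);
(`EndoData.Interprets.minus_orthogonal_iff`) at a symplectic or even-orthogonal scope `G_-` is (even)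
orthogonal iff `s ∈ A_ψ⁺` iff `dim ψ_-` is even (`ParamShape.inAPlus_iff_dimMinus_even`) — the case
distinction of the support convention `L1522–L1524`.  NOT typed (DIVERGENCE D-TY-63): the discriminant tag
`η′` of an even-orthogonal factor (`= det(ψ_κ ⊗ η_κ)`; `det` is not a datum of `ParamShape`), the characters
`η_±`, the `L`-embedding `ξ` of Rem. 1.6.1 (2), transfer factors; at `GL` scopes no constraint is imposed.

§17.2 NAMES the supplementary assumptions of [AGIKMS] Thm D.2.1 = `2.5.5` (`L13392–L13405`), which §11's
`AGIKMS.ThmD21C I E suppl` carries as ONE opaque premise `suppl` (GAPS G-TY-5-3 (e)): over a Whittaker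
signature `WhittakerData` (`IsGeneric s π` = "π is 𝔴-generic", `IsGenericM` on Levi subgroups): the tempered
packet statement Conj. D.1.1 = `TPC` of App. D for a packet with pairing (`Packet.TPCAt`); for `φ_M` its
genericity half only (`LeviData.TPCM` — §11's Levi signature carries no pairing on `M`, D-TY-66); TPC for the
endoscopic factorisations `φ′` (`L13393–L13394`) at the two factor scopes; the heredity property (`L13398–L13401`,
citing [Rod], [CS, Cor. 1.7]; `LeviData.Heredity`); and "We assume that this scalar is $1$." (`L13404`,
`LeviData.WhittakerScalarOne`) — assembled as `AGIKMS.D21Suppl` and plugged into §11's schematic theorem: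
`AGIKMS.ThmD21N Pk I E W := AGIKMS.ThmD21C I E (AGIKMS.D21Suppl Pk I E W)` (`AGIKMS.thmD21N_iff`, `Iff.rfl`).
Cor. D.1.3 = `strong-shahidi-arthur` (`L13395`: "In the setting of classical groups, this follows from Corollary
\ref{strong-shahidi-arthur}.") is recorded as the edge `AGIKMS.CorD13` from (ECR1)+(ECR2) to `TPCAt`.

§17.3 types [AGIKMS] Hypothesis 4.4.2 = `\label{ECR}` (`L6416–L6424`) over a duality signature `DualityData`
(`hat` = `ψ ↦ ψ̂`, `phiOf` = `ψ ↦ φ_ψ`, `charLift` = the injection `Ŝ_{φ_ψ} ↪ Ŝ_ψ`): `AGIKMS.HypECRC`, the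
clause on proper Levi subgroups `M ≅ GL × ⋯ × G_0` being READ on the classical factor `G_0`
(`ClassicalType.leviFactorOf`, D-TY-67), whose `dim St` is smaller (`ClassicalType.stdDim_lt_of_leviFactorOf`);
proves Remark 4.4.3 (`L6433–L6435`) in the kernel (`HypArthurC.hypECR`: `hyp.arthur` at `s` and (ECR1),
(ECR2) for `φ̂` give Hypothesis `ECR` for a tempered `φ`); and types the statement that the proof of [AGIKMS]
Prop. 4.5.1 = `c-irred` takes from the Book BEYOND Hypothesis `ECR` as printed (cell DIVERGENCE D-UP-15;
`L6782–L6784`, VERBATIM: "By \cite[Proposition 7.4.1]{Ar} and \cite[Proposition 8.4.1]{Mok} which we can use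
because we are assuming Hypothesis \ref{ECR}, we can take $\pi$ to be an element in the associated $L$-packet
$\Pi_{\phi_\psi}$."): [Mok] Prop. 8.4.1 = [Ar, Prop. 7.4.1] (`Book.P741`, VERBATIM from `main.tex:L9107–
L9112`), the STRENGTHENED hypothesis `HypArthurCPlus := HypArthurC ∧ (Prop. 7.4.1 at every scope of smaller
dim St)`, its projection `HypArthurCPlus.printed` onto §11's `HypArthurC`, and `HypArthurCPlus.phiPsi_sub`
(under the strengthened hypothesis `Π_{φ_ψ′} ⊂ Π_{ψ′}` with multiplicity one and compatible characters for every
smaller `G′`, the form in which the proof of Prop. 4.5.1 uses it).  So §11's `AGIKMS.Main3C : … → HypArthurC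
… → …` is visibly stated from the PRINTED hypothesis, literally weaker than what the printed proof invokes; no
status word changes (in the DAG of module `DependencyDag` both live inside `IH N`).

Sources and conventions as in `Leaves/Scopes.lean` and `Leaves/Intertwining.lean`: [AGIKMS] = `AGIKMS2024`
(arXiv:2410.13504v3, `note30.tex`; PREPRINT under review — hence `[claim: AGIKMS2024, under-review]`; the v3 PDF
numbers quoted here — Rem. 1.6.1, Hyp. 1.10.4, Hyp. 4.4.2, Rem. 4.4.3, Prop. 4.5.1, Conj. D.1.1, Cor. D.1.3, Thm
D.2.1 — are computed from the TeX counters `\newtheorem{thm}{Theorem}[subsection]`, `L153–L163`, with the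
unnumbered `\section*{Introduction}`, `L282`); [Mok] = `Mok2012` (arXiv:1206.0882, `main.tex`); the Book
`Arthur2013` is NOT HELD by the cell (acq-04129) — "[Ar, Prop. 7.4.1]" is the locator printed by [Mok] and
[AGIKMS], second-hand.  Schematic simplifications: the cell's `DIVERGENCE.md` D-TY-63 … D-TY-68.
No `axiom`, `sorry`, `opaque`.
-/

set_option autoImplicit false

namespace Literature.NumberTheory.Automorphic.Arthur2013.Leaves

/-! ## §17.1  `dim ψ_±`, the factors `G_±` as a function of `(G, dim ψ_±)`, `EndoData.Interprets`, and what `hyp.arthur` then covers -/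

section EndoGroups

/-- `(finRange |l|).map (f ∘ l.get) = l.map f`. [folklore] (list bookkeeping; `List.ext_getElem`) -/
theorem map_finRange_get {α β : Type} (l : List α) (f : α → β) :
    ((List.finRange l.length).map fun j => f (l.get j)) = l.map f :=
  List.ext_getElem (by simp) (fun i h₁ h₂ => by simp)

/-- a sum over a list splits along a Boolean predicate and its negation. [folklore] (list bookkeeping, induction) -/
theorem sum_filter_add_sum_filter_not {α : Type} (l : List α) (p : α → Bool) (f : α → Nat) :
    ((l.filter fun a => p a).map f).sum + ((l.filter fun a => !p a).map f).sum = (l.map f).sum := by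
  induction l with
  | nil => rfl
  | cons a t ih =>
    cases hp : p a <;> simp [hp] at ih ⊢ <;> omega

/-- the parity of a sum of naturals is the parity of the number of its odd terms. [folklore] (list bookkeeping, induction) -/
theorem length_filter_odd_mod_two {α : Type} (l : List α) (f : α → Nat) :
    (l.filter fun a => f a % 2 == 1).length % 2 = (l.map f).sum % 2 := by
  induction l with
  | nil => rfl
  | cons a t ih =>
    rw [List.filter_cons, List.map_cons, List.sum_cons]
    split
    · rename_i h
      rw [List.length_cons]
      simp only [beq_iff_eq] at h
      omega
    · rename_i h
      simp only [beq_iff_eq] at h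
      omega

namespace ParamShape

variable {Λ : Type}

/-- **`dim ψ_-`** for `s = x ∈ A_ψ` — the dimension of §11's `restrict` ([AGIKMS] `note30.tex:L1507–L1510`,
VERBATIM: "For $s = \sum_{i \in I_-} e(\phi_i, d_i) \in A_\psi$, set $\psi_\pm$ as \begin{align*} \psi_- =
\bigoplus_{i \in I_-} \phi_i \boxtimes S_{d_i},"): `Σ_{i ∈ I_-} dim(φ_i) d_i` (`dimMinus_eq`).
[claim: AGIKMS2024, under-review] (§1.6 notation l.1507-1510; not a theorem) -/
def dimMinus (ψ : ParamShape Λ) (x : ψ.AElt) : Nat := (ψ.restrict x).dim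

/-- **`dim ψ_+`**, `ψ_+ = ψ - ψ_-` (`note30.tex:L1512`, VERBATIM: "\psi_+ = \psi - \psi_-.") — the dimension of
§11's `corestrict` (the complementary summands together with `ψ_bad ⊕ {}^cψ_bad^∨`): `2 dim ψ_bad + Σ_{i ∉ I_-}
dim(φ_i) d_i` (`dimPlus_eq`). [claim: AGIKMS2024, under-review] (§1.6 notation l.1512; not a theorem) -/
def dimPlus (ψ : ParamShape Λ) (x : ψ.AElt) : Nat := (ψ.corestrict x).dim

/-- the `Σ dim(φ_i) d_i` part of `restrict` is the sum over the summands selected by `x`.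
[folklore] (bookkeeping: re-indexing a filtered list through `List.get`) -/
theorem restrict_sum (ψ : ParamShape Λ) (y : ψ.AElt) :
    ((List.finRange (ψ.restrict y).k).map fun j => (ψ.restrict y).dimφ j * (ψ.restrict y).d j).sum =
      (((List.finRange ψ.k).filter fun i => y i).map fun i => ψ.dimφ i * ψ.d i).sum := by
  unfold restrict
  dsimp only
  generalize ((List.finRange ψ.k).filter fun i => y i) = L
  exact congrArg List.sum (map_finRange_get L fun i => ψ.dimφ i * ψ.d i)

/-- `dim ψ_- = Σ_{i ∈ I_-} dim(φ_i) d_i`. [folklore] (bookkeeping, from `restrict_sum`) -/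
theorem dimMinus_eq (ψ : ParamShape Λ) (x : ψ.AElt) :
    ψ.dimMinus x = (((List.finRange ψ.k).filter fun i => x i).map fun i => ψ.dimφ i * ψ.d i).sum := by
  unfold dimMinus dim
  rw [restrict_sum]
  have h0 : (ψ.restrict x).dimBad = 0 := rfl
  rw [h0]
  omega

/-- `dim ψ_+ = 2 dim ψ_bad + Σ_{i ∉ I_-} dim(φ_i) d_i`. [folklore] (bookkeeping, from `restrict_sum`) -/
theorem dimPlus_eq (ψ : ParamShape Λ) (x : ψ.AElt) :
    ψ.dimPlus x = 2 * ψ.dimBad + (((List.finRange ψ.k).filter fun i => !x i).map fun i => ψ.dimφ i * ψ.d i).sum := by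
  unfold dimPlus corestrict dim
  dsimp only
  rw [restrict_sum]

/-- **`dim ψ_+ + dim ψ_- = dim ψ = N`** — so the ranks of the two factors of the endoscopic group add up
([AGIKMS] `note30.tex:L14154`: "with $n_1+n_2=n$"; [Mok] `main.tex:L777`: "N_1,N_2 \geq 0, \,\ N= N_1 + N_2").
[folklore] (kernel-checked arithmetic of the notation `ψ_+ = ψ - ψ_-`) -/
theorem dimPlus_add_dimMinus (ψ : ParamShape Λ) (x : ψ.AElt) : ψ.dimPlus x + ψ.dimMinus x = ψ.dim := by
  rw [dimPlus_eq, dimMinus_eq]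
  unfold dim
  have h := sum_filter_add_sum_filter_not (List.finRange ψ.k) x (fun i => ψ.dimφ i * ψ.d i)
  omega

/-- `dim ψ_- = 0` at `s = 0 ∈ A_ψ` (then `G_-` is the trivial group and `G_+ = G`). [folklore] (the filter by `false` is empty) -/
theorem dimMinus_zero (ψ : ParamShape Λ) : ψ.dimMinus (AElt.zero ψ) = 0 := by
  rw [dimMinus_eq]
  unfold AElt.zero
  rw [List.filter_eq_nil_iff.mpr fun _ _ => by simp]
  rfl

/-- **`s ∈ A_ψ⁺` iff `dim ψ_-` is even** — `A_ψ⁺ = ker(e(φ_i,d_i) ↦ dim(φ_i ⊠ S_{d_i}) mod 2)` (`note30.tex:L1403–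
L1406`, §11 `AElt.inAPlus`) evaluated at `s = Σ_{i ∈ I_-} e(φ_i, d_i)` is `dim ψ_- mod 2`; this is the case
distinction of [AGIKMS]'s support convention (`L1522–L1524`, VERBATIM): "when $G = \O_{2n}(F)$ and $s \in
A_\psi^+$ (\resp $s \not\in A_\psi^+$), we further assume that $f_G(g) = 0$ for $g \in \O_{2n}(F) \setminus
\SO_{2n}(F)$ (\resp for $g \in \SO_{2n}(F)$),".  [folklore] (kernel-checked parity count) -/
theorem inAPlus_iff_dimMinus_even (ψ : ParamShape Λ) (x : ψ.AElt) :
    x.inAPlus = true ↔ ψ.dimMinus x % 2 = 0 := by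
  rw [dimMinus_eq]
  unfold AElt.inAPlus
  have hf : ((List.finRange ψ.k).filter fun i => x i && (ψ.dimφ i * ψ.d i) % 2 == 1) =
      (((List.finRange ψ.k).filter fun i => x i).filter fun i => (ψ.dimφ i * ψ.d i) % 2 == 1) := by
    rw [List.filter_filter]
    congr 1
    funext i
    exact Bool.and_comm _ _
  rw [hf, length_filter_odd_mod_two]
  simp

end ParamShape

/-- the tag is a general linear group `GL_N(E)` (not one of the four classical families of [AGIKMS] §1.6,
`note30.tex:L1319–L1323`, VERBATIM: "Next, let $G$ be one of the following quasi-split classical groups \[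
\SO_{2n+1}(F), \quad \Sp_{2n}(F), \quad \O_{2n}^\eta(F), \quad \U_n. \]"). [folklore] (tag reading) -/
def ClassicalType.isGL : ClassicalType → Bool
  | .GL _ _ => true
  | _ => false

/-- **The classical groups `G_κ` with `ψ_κ ⊗ η_κ ∈ Ψ(G_κ)`, as a function of the family of `G` and `m = dim ψ_κ`.**
[AGIKMS] `note30.tex:L1328–L1339`, VERBATIM: "We denote by $\St_{\widehat{G}}$ the standard representation of
$\widehat{G^\circ}$, and set \[ N = \dim(\St_{\widehat{G}}) = \left\{ \begin{aligned} &2n \iif G =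
\SO_{2n+1}(F), \O_{2n}^\eta(F), \\ &2n+1 \iif G = \Sp_{2n}(F), \\ &n \iif G = \U_n. \end{aligned} \right. \]";
`L1342–L1360`: "Let $\Psi(G)$ be the set of equivalence classes of conjugate-self-dual representations $\psi
\colon L_E \times \SL_2(\C) \rightarrow \GL_N(\C)$ with \begin{align*} \text{sign} &= \left\{ \begin{aligned}
&{-1} \iif G = \SO_{2n+1}(F), \\ &{+1} \iif G = \Sp_{2n}(F), \O_{2n}(F),\\ &(-1)^{n-1} \iif G = \U_n,
\end{aligned} \right. \\ \det(\psi) &= \left\{ \begin{aligned} &\1 \iif G = \SO_{2n+1}(F), \Sp_{2n}(F),\\ &\eta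
\iif G = \O_{2n}^\eta(F). \end{aligned} \right. \end{align*}"; `L1514–L1515`: "Fix a conjugate-self-dual
character $\eta_\pm$ of $E^\times$ such that there is a classical group $G_\pm$ satisfying that $\psi_\pm
\otimes \eta_\pm \in \Psi(G_\pm)$."; Rem. 1.6.1 (3), `L1560–L1567`: "A non-trivial pair of characters $(\eta_+,
\eta_-)$ is necessary when $G = \Sp_{2n}(F)$ or $G = \U_n$ in general. More precisely, if $G = \Sp_{2n}(F)$ and
$\dim(\psi_\kappa) \equiv 1 \bmod 2$, we must take $\eta_{\kappa} = \det(\psi_\kappa)$. If $G = \U_n$ and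
$\dim(\psi_\kappa) \not\equiv n \bmod 2$, we need to choose a conjugate-symplectic character $\eta_\kappa$, for
which there is no canonical choice."  READ OFF (the summand `ψ_κ` has the sign of `ψ`; a quadratic `η_κ` keeps
sign and dimension, a conjugate-symplectic one flips the sign): `G = SO_{2n+1}` (sign `-1`): `G_κ = SO_{m+1}`,
`m` even; `G = Sp_{2n}` or `O_{2n}` (sign `+1`): `G_κ = Sp_{m-1}` if `m` is odd (det made trivial by `η_κ`),
`G_κ = O_m^{η′}` if `m` is even; `G = U_n`: `G_κ = U_m`.  Cross-checks: the table `L14142–L14154`, VERBATIM: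
"Recall that $G'(F)$ is of the form \[ G'(F) = \left\{ \begin{aligned} & \Sp_{2n_1}(F) \times
\SO_{2n_2}^{\eta}(F) \iif G(F) = \Sp_{2n}(F), \\ & \SO_{2n_1+1}(F) \times \SO_{2n_2+1}(F) \iif G(F) =
\SO_{2n+1}(F), \\ & \SO_{2n_1}^{\eta_1}(F) \times \SO_{2n_2}^{\eta_2}(F) \iif G(F) = \SO_{2n}^\eta(F), \\ &
\U_{n_1} \times \U_{n_2} \iif G(F) = \U_n \end{aligned} \right. \] with $n_1+n_2=n$ and $\eta_1 \eta_2 = \eta$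
(see e.g., \cite[Section 1.8]{W5})." (standard endoscopy of the connected group; for [AGIKMS]'s `O_{2n}` with
`s ∉ A_ψ⁺` both `dim ψ_±` are odd and both factors symplectic — the functions are then supported off
`SO_{2n}(F)`, `L1522–L1524`); [Mok] `main.tex:L772–L777`, VERBATIM: "The set $\mathcal{E}_{\ellip}(G)$ of
(equivalence classes of) elliptic endoscopic data of $G=U_{E/F}(N)$ are determined by Rogawski (\cite{R} section
4.6). They are given by \[ (G^{\prime},\xi^{\prime}) = (U_{E/F}(N_1) \times U_{E/F}(N_2),
\zeta_{\underline{\chi}}) \] \begin{eqnarray*} & & N_1,N_2 \geq 0, \,\ N= N_1 + N_2 ,".  TYPED as a Boolean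
relation `G.endoFactor m t` = "`t` is an admissible type for `G_κ` when `dim ψ_κ = m`": the family of `t` and
`dim St_{t̂} = m` (`stdDim_of_endoFactor`); the discriminant tag of an even-orthogonal `t` is unconstrained and
`GL` tags impose nothing (DIVERGENCE D-TY-63).
[claim: AGIKMS2024, under-review] (read off the definition of Ψ(G), l.1328-1360, with l.1514-1515 and Rem. 1.6.1 (3) l.1560-1567; table l.14142-14154; Mok2012 l.772-777) -/
def ClassicalType.endoFactor : ClassicalType → Nat → ClassicalType → Bool
  | .SOodd _, m, .SOodd a => m == 2 * a
  | .Sp _, m, .Sp a => m == 2 * a + 1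
  | .Sp _, m, .SOeven a _ => m == 2 * a
  | .SOeven _ _, m, .Sp a => m == 2 * a + 1
  | .SOeven _ _, m, .SOeven a _ => m == 2 * a
  | .U _, m, .U a => m == a
  | .GL _ _, _, _ => true
  | _, _, _ => false

/-- an admissible factor type has `dim St_{Ĝ_κ} = dim ψ_κ` (§11 `ClassicalType.stdDim`). [folklore] (`decide`-level case analysis, proved) -/
theorem ClassicalType.stdDim_of_endoFactor {G t : ClassicalType} {m : Nat} (hG : G.isGL = false)
    (h : G.endoFactor m t = true) : t.stdDim = m := by
  cases G <;> cases t <;> simp_all [ClassicalType.endoFactor, ClassicalType.stdDim, ClassicalType.isGL]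

/-- at a symplectic or even-orthogonal `G`, the factor `G_κ` is (even) orthogonal iff `dim ψ_κ` is even, symplectic
iff it is odd (Rem. 1.6.1 (3), `L1563–L1564`). [folklore] (case analysis, proved) -/
theorem ClassicalType.endoFactor_isTypeD_iff {G t : ClassicalType} {m : Nat}
    (hG : (∃ n, G = .Sp n) ∨ ∃ n η, G = .SOeven n η) (h : G.endoFactor m t = true) :
    t.isTypeD = true ↔ m % 2 = 0 := by
  rcases hG with ⟨n, rfl⟩ | ⟨n, η, rfl⟩ <;> cases t <;>
    simp_all [ClassicalType.endoFactor, ClassicalType.isTypeD]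

/-- the clause of `hyp.arthur` on the cell's tags, examples (cf. §11 `hypArthur_stdDim_examples`): in `Sp_6`
(`N = 7`) a split `dim ψ_+ + dim ψ_- = 3 + 4` has factors `Sp_2 × O_4^{η′}`, in `O_8` an odd split `3 + 5` has
factors `Sp_2 × Sp_4`, in `SO_7` (`N = 6`) `2 + 4` gives `SO_3 × SO_5`, in `U_5` `2 + 3` gives `U_2 × U_3`; `Sp_4`
(`dim St = 5`) is not a factor for `m = 4`. [folklore] (`decide`) -/
theorem endoFactor_examples :
    (ClassicalType.Sp 3).endoFactor 3 (.Sp 1) = true ∧ (ClassicalType.Sp 3).endoFactor 4 (.SOeven 2 false) = true ∧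
    (ClassicalType.SOeven 4 true).endoFactor 3 (.Sp 1) = true ∧ (ClassicalType.SOeven 4 true).endoFactor 5 (.Sp 2) = true ∧
    (ClassicalType.SOodd 3).endoFactor 2 (.SOodd 1) = true ∧ (ClassicalType.SOodd 3).endoFactor 4 (.SOodd 2) = true ∧
    (ClassicalType.U 5).endoFactor 2 (.U 2) = true ∧ (ClassicalType.U 5).endoFactor 3 (.U 3) = true ∧
    (ClassicalType.Sp 3).endoFactor 4 (.Sp 2) = false := by decide

variable {Ω : World} {D : ShapeData Ω}

/-- **`N = dim(St_Ĝ) = dim ψ`** — the shapes recorded by `D` have the dimension of the scope's type: [AGIKMS]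
`note30.tex:L1331` "N = \dim(\St_{\widehat{G}})" with `L1343` "$\psi \colon L_E \times \SL_2(\C) \rightarrow
\GL_N(\C)$" (quoted in full under `ClassicalType.endoFactor`).  A well-formedness property of the bookkeeping
datum `ShapeData` (§5), used as a hypothesis. [claim: AGIKMS2024, under-review] (§1.6 notation l.1328-1343, as a constraint on the cell's `ShapeData`) -/
def ShapeData.DimSound (D : ShapeData Ω) : Prop :=
  ∀ (s : LocalClassicalScope) (p : Ω.Param s), (D.shape s p).dim = s.type.stdDim

/-- **The endoscopic data INTERPRET `(G_+, G_-)`** — the constraint GAPS G-TY-5-3 (c) asks for, on §11's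
uninterpreted `EndoData`: for every `(G, ψ, x)` at scope `s`, the factor scopes `e₁ = G_+`, `e₂ = G_-` have the
base field of `s`, are quasi-split ([AGIKMS] `L1319` "quasi-split classical groups"; the elliptic endoscopic
groups of [Mok] `L774` are the quasi-split `U_{E/F}(N_1) × U_{E/F}(N_2)`), carry the parameter-kind tag of `s`,
and have types admissible for `dim ψ_+` resp. `dim ψ_-` (`ClassicalType.endoFactor`).  Not typed: `η_±`, the
discriminant tags, the `L`-embedding, transfer factors (D-TY-63); the tag equalities `field`/`params` are the
cell's bookkeeping (D-TY-64). [claim: AGIKMS2024, under-review] (G_± of l.1514-1515 with Rem. 1.6.1 (3), as a constraint on the signature `EndoData`) -/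
def EndoData.Interprets (E : EndoData Ω D) : Prop :=
  ∀ (s : LocalClassicalScope) (p : Ω.Param s) (x : (D.shape s p).AElt),
    ((E.e₁ s p x).field = s.field ∧ (E.e₁ s p x).form = .quasiSplit ∧ (E.e₁ s p x).params = s.params ∧
      s.type.endoFactor ((D.shape s p).dimPlus x) (E.e₁ s p x).type = true) ∧
    ((E.e₂ s p x).field = s.field ∧ (E.e₂ s p x).form = .quasiSplit ∧ (E.e₂ s p x).params = s.params ∧
      s.type.endoFactor ((D.shape s p).dimMinus x) (E.e₂ s p x).type = true)

/-- under the interpretation, `dim St_{Ĝ_+} + dim St_{Ĝ_-} = dim ψ` at every classical (non-`GL`) scope.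
[folklore] (from `stdDim_of_endoFactor` and `dimPlus_add_dimMinus`, proved) -/
theorem EndoData.Interprets.stdDim_add {E : EndoData Ω D} (hE : E.Interprets) (s : LocalClassicalScope)
    (hs : s.type.isGL = false) (p : Ω.Param s) (x : (D.shape s p).AElt) :
    (E.e₁ s p x).type.stdDim + (E.e₂ s p x).type.stdDim = (D.shape s p).dim := by
  obtain ⟨⟨-, -, -, h₁⟩, ⟨-, -, -, h₂⟩⟩ := hE s p x
  rw [ClassicalType.stdDim_of_endoFactor hs h₁, ClassicalType.stdDim_of_endoFactor hs h₂]
  exact (D.shape s p).dimPlus_add_dimMinus x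

/-- under the interpretation and `N = dim St_Ĝ`, for PROPER `s` (`ψ_+ ≠ 0 ≠ ψ_-`) both factors have strictly
smaller `dim St` than `G` — the order of [AGIKMS] Hypothesis 1.10.4 = `hyp.arthur` (`note30.tex:L2333–L2334`, VERBATIM:
"all $A$-parameters for $G'$ with $G'$ any classical group such that $\dim(\St_{\widehat{G'}}) <
\dim(\St_{\widehat{G}})$."). [folklore] (arithmetic, proved) -/
theorem EndoData.Interprets.stdDim_lt {E : EndoData Ω D} (hE : E.Interprets) (s : LocalClassicalScope)
    (hs : s.type.isGL = false) (p : Ω.Param s) (hD : (D.shape s p).dim = s.type.stdDim)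
    (x : (D.shape s p).AElt) (hm : 0 < (D.shape s p).dimMinus x) (hp : 0 < (D.shape s p).dimPlus x) :
    (E.e₁ s p x).type.stdDim < s.type.stdDim ∧ (E.e₂ s p x).type.stdDim < s.type.stdDim := by
  obtain ⟨⟨-, -, -, h₁⟩, ⟨-, -, -, h₂⟩⟩ := hE s p x
  have hsum := (D.shape s p).dimPlus_add_dimMinus x
  rw [ClassicalType.stdDim_of_endoFactor hs h₁, ClassicalType.stdDim_of_endoFactor hs h₂]
  omega

/-- **What `hyp.arthur` covers, kernel-checked.**  [AGIKMS] DEFINE the endoscopic side of (ECR2) by the packets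
of `G_±` (`note30.tex:L1526–L1535`, §11 `ECR2viaPackets`), and Hypothesis 1.10.4 = `hyp.arthur` grants "$A$-packets
satisfying \eqref{ECR1}, \eqref{ECR2} and \eqref{A-LIR} associated to […] all $A$-parameters for $G'$ with $G'$
any classical group such that $\dim(\St_{\widehat{G'}}) < \dim(\St_{\widehat{G}})$." (`L2328–L2334`; §11
`HypArthurC`, clause 3).  At a quasi-split classical scope with `N = dim St_Ĝ`, for endoscopic data that
INTERPRET `(G_+, G_-)` and every PROPER `x ∈ A_ψ`, that clause yields (ECR1) and (ECR2) for the two factor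
parameters `ψ_± ⊗ η_±` and (A-LIR) at the two factor scopes.  (At `x = 0` the factor `G_+` is `G` itself —
`dimMinus_zero` — and is NOT covered: (ECR2) there is the stability of `Π_ψ`'s own sum, part of what is being
proved.) [folklore] (kernel-checked consequence of the typed hypothesis; no source states it in this form) -/
theorem HypArthurC.endoscopic {Pk : PacketAssignment Ω D} {I : LeviData Ω D} {E : EndoData Ω D}
    {s : LocalClassicalScope} (hH : HypArthurC Pk I E s) (hE : E.Interprets) (hs : s.type.isGL = false)
    (hqs : s.form = .quasiSplit) (p : Ω.Param s) (hD : (D.shape s p).dim = s.type.stdDim)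
    (x : (D.shape s p).AElt) (hm : 0 < (D.shape s p).dimMinus x) (hp : 0 < (D.shape s p).dimPlus x) :
    (((Pk (E.e₁ s p x) (E.q₁ s p x)).ECR1 (E.q₁ s p x) (D.indexGG0 (E.e₁ s p x)) ∧
        ∀ x', ECR2 Pk E (E.e₁ s p x) (E.q₁ s p x) x') ∧
      ∀ (L : I.Levi (E.e₁ s p x)) (ψM : I.ParamM (E.e₁ s p x) L) (u : I.NEl (E.e₁ s p x) L ψM),
        ALIR I E (E.e₁ s p x) L ψM u) ∧
    (((Pk (E.e₂ s p x) (E.q₂ s p x)).ECR1 (E.q₂ s p x) (D.indexGG0 (E.e₂ s p x)) ∧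
        ∀ x', ECR2 Pk E (E.e₂ s p x) (E.q₂ s p x) x') ∧
      ∀ (L : I.Levi (E.e₂ s p x)) (ψM : I.ParamM (E.e₂ s p x) L) (u : I.NEl (E.e₂ s p x) L ψM),
        ALIR I E (E.e₂ s p x) L ψM u) := by
  obtain ⟨⟨hf₁, hq₁, -, -⟩, ⟨hf₂, hq₂, -, -⟩⟩ := hE s p x
  obtain ⟨lt₁, lt₂⟩ := hE.stdDim_lt s hs p hD x hm hp
  obtain ⟨-, -, h3⟩ := hH
  have c₁ := h3 (E.e₁ s p x) hf₁ (hq₁.trans hqs.symm) lt₁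
  have c₂ := h3 (E.e₂ s p x) hf₂ (hq₂.trans hqs.symm) lt₂
  exact ⟨⟨c₁.1 _, c₁.2⟩, ⟨c₂.1 _, c₂.2⟩⟩

/-- under the interpretation, at a symplectic or even-orthogonal scope **`G_-` is orthogonal iff `s ∈ A_ψ⁺`**
(iff `dim ψ_-` is even) — the two cases of the support convention `L1522–L1524` (quoted under
`ParamShape.inAPlus_iff_dimMinus_even`). [folklore] (kernel-checked, from `endoFactor_isTypeD_iff` and the parity count) -/
theorem EndoData.Interprets.minus_orthogonal_iff {E : EndoData Ω D} (hE : E.Interprets) (s : LocalClassicalScope)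
    (hG : (∃ n, s.type = .Sp n) ∨ ∃ n η, s.type = .SOeven n η) (p : Ω.Param s) (x : (D.shape s p).AElt) :
    (E.e₂ s p x).type.isTypeD = true ↔ x.inAPlus = true := by
  obtain ⟨-, ⟨-, -, -, h₂⟩⟩ := hE s p x
  rw [ClassicalType.endoFactor_isTypeD_iff hG h₂, ParamShape.inAPlus_iff_dimMinus_even]

end EndoGroups

/-! ## §17.2  The supplementary assumptions of [AGIKMS] Thm D.2.1 (= `2.5.5`), NAMED -/

section D21

variable {Ω : World} {D : ShapeData Ω}

/-- **Whittaker data, UNINTERPRETED**: for the fixed Whittaker datum `𝔴` of `G` at scope `s` ([AGIKMS] App. D,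
`note30.tex:L13342`: "a quasi-split connected reductive $F$-group equipped with a Whittaker datum $\ww$"),
`IsGeneric s π` = "`π` is `𝔴`-generic" and, for a standard Levi `M` of §11's `LeviData`, `IsGenericM s L π_M` =
"`π_M` is `𝔴_M`-generic". [folklore] (a first-order signature for the audit; no source asserts anything here) -/
structure WhittakerData (Ω : World) (D : ShapeData Ω) (I : LeviData Ω D) where
  /-- `π ∈ Irr(G)` is `𝔴`-generic -/
  IsGeneric : (s : LocalClassicalScope) → Ω.Irr s → Prop
  /-- `π_M ∈ Irr(M)` is `𝔴_M`-generic -/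
  IsGenericM : (s : LocalClassicalScope) → (L : I.Levi s) → I.IrrM s L → Prop

variable {I : LeviData Ω D}

/-- **The tempered `L`-packet statement Conj. D.1.1 = `TPC` of [AGIKMS] App. D for a packet with pairing**
(`note30.tex:L13290–L13294`, VERBATIM): "\begin{conj} \label{TPC} Fix a Whittaker datum $\ww$ for $G$. The
$L$-packet $\Pi_\phi$ contains exactly one $\ww$-generic member $\pi_\ww$, and it satisfies
$\pair{\cdot,\pi_\ww}_\phi = \1$. \end{conj}"; setting `L13284–L13287`: "We assume that the corresponding
$L$-packet $\Pi_\phi$ and its pairing with $\Sc_\phi$ have been constructed, giving an injective map from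
$\Pi_\phi$ to the set of irreducible representations of $\Sc_\phi$; we use the notation $\pair{s,\pi}_\phi$ for
the trace at $s$ of the representation of $\Sc_\phi$ associated to $\pi$. Note that the pairing $\pair{\cdot,
\pi}_\phi$ depends on $\ww$." (known for archimedean `F` by Shelstad, `L13296`).  TYPED for `P : Packet Ω s ψ`
and Whittaker data `W`: some member is `𝔴`-generic, every `𝔴`-generic member equals it, and its character
`⟨·, π_𝔴⟩` is trivial.  An OPEN statement in general — recorded as the HYPOTHESIS it is in Thm D.2.1, never as a fact.
[claim: AGIKMS2024, under-review] (Conj. D.1.1 = `TPC`, l.13290-13294, typed as a predicate on packets; used only as a premise) -/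
def Packet.TPCAt (W : WhittakerData Ω D I) {s : LocalClassicalScope} {Λ : Type} {ψ : ParamShape Λ}
    (P : Packet Ω s ψ) : Prop :=
  ∃ π, π ∈ P.members ∧ W.IsGeneric s π ∧ (∀ π', π' ∈ P.members → W.IsGeneric s π' → π' = π) ∧
    ∀ x : ψ.AElt, (P.pairing π).eval x = 1

/-- **TPC for `φ_M`, genericity half** (`note30.tex:L13396–L13397`, VERBATIM: "Thus, we know that there is a
unique $\ww_M$-generic member $\pi_{M,\ww} \in \Pi_{\phi_M}$ and it satisfies $\pair{\cdot, \pi_{M,\ww}}_{\phi_M}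
= \1$."): the packet `Π_{φ_M}` of §11's Levi data has exactly one `𝔴_M`-generic member.  The pairing half is NOT
typed (`LeviData` carries no pairing on `M`, DIVERGENCE D-TY-66).
[claim: AGIKMS2024, under-review] (assumption of Thm D.2.1, l.13393-13397) -/
def LeviData.TPCM (I : LeviData Ω D) (W : WhittakerData Ω D I) (s : LocalClassicalScope) (L : I.Levi s)
    (φM : I.ParamM s L) : Prop :=
  ∃ πM, πM ∈ I.packetM s L φM ∧ W.IsGenericM s L πM ∧
    ∀ πM', πM' ∈ I.packetM s L φM → W.IsGenericM s L πM' → πM' = πM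

/-- **the heredity property** (`note30.tex:L13398–L13401`, VERBATIM): "Let $\Pi_\phi$ be the set consisting of
the irreducible constituents of the representations $I_P(\pi_M)$, as $\pi_M$ runs over $\Pi_{\phi_M}$. According
to the heredity property (\cite{Rod}, \cite[Corollary 1.7]{CS}), there is a unique $\ww$-generic member
$\pi_\ww$ of $\Pi_\phi$ and it lies in $I_P(\pi_{M,\ww})$."  TYPED over §11's `constituents`: for the
`𝔴_M`-generic `π_{M,𝔴} ∈ Π_{φ_M}` there is a `𝔴`-generic constituent of `I_P(π_{M,𝔴})`, and every `𝔴`-generic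
constituent of any `I_P(π_M)`, `π_M ∈ Π_{φ_M}`, equals it.  ([Rod] = Rodier, [CS] = Casselman–Shalika in
[AGIKMS]'s bibliography; their statements are not reproduced here — this is [AGIKMS]'s use of them, D-TY-66.)
[claim: AGIKMS2024, under-review] (assumption paragraph of Thm D.2.1, l.13398-13401, citing [Rod], [CS, Cor. 1.7]) -/
def LeviData.Heredity (I : LeviData Ω D) (W : WhittakerData Ω D I) (s : LocalClassicalScope) (L : I.Levi s)
    (φM : I.ParamM s L) : Prop :=
  ∀ πM, πM ∈ I.packetM s L φM → W.IsGenericM s L πM →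
    ∃ π, π ∈ I.constituents s L πM ∧ W.IsGeneric s π ∧
      ∀ πM', πM' ∈ I.packetM s L φM → ∀ π', π' ∈ I.constituents s L πM' → W.IsGeneric s π' → π' = π

/-- **"We assume that this scalar is $1$."** (`note30.tex:L13402–L13405`, VERBATIM): "Then the action of the
operator $\pair{u,\tl\pi_{M,\ww}} R_P(w_u, \tl\pi_{M,\ww},\phi_M)$ on $I_P(\pi_{M,\ww})$ must preserve
$\pi_\ww$, and hence acts on it by a scalar. We assume that this scalar is $1$. For classical groups, this
follows from Theorem \ref{main1} (1) together with Lemma \ref{c3}."  TYPED over §11's `actsBy`: on the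
`𝔴`-generic constituent `π_𝔴` of `I_P(π_{M,𝔴})` every operator `⟨ũ, π̃_{M,𝔴}⟩ R_P(w_u, π̃_{M,𝔴}, φ_M)` acts by
`1`.  (Thm 1.8.1 = `main1` with operators is §16, `Leaves/Operators.lean`; Lemma 6.3.1 = `c3` is not typed.)
[claim: AGIKMS2024, under-review] (assumption of Thm D.2.1, l.13402-13405) -/
def LeviData.WhittakerScalarOne (I : LeviData Ω D) (W : WhittakerData Ω D I) (s : LocalClassicalScope)
    (L : I.Levi s) (φM : I.ParamM s L) : Prop :=
  ∀ πM, πM ∈ I.packetM s L φM → W.IsGenericM s L πM → ∀ π, π ∈ I.constituents s L πM → W.IsGeneric s π →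
    ∀ u : I.NEl s L φM, I.actsBy s L φM u πM π 1

/-- **The supplementary assumptions of [AGIKMS] Thm D.2.1 = `2.5.5`, assembled** (`note30.tex:L13392–L13395`,
VERBATIM): "The supplementary assumptions concern expected properties of $L$-packets, as follows. We assume
that" [Conj. D.1.1] "\ref{TPC} holds for the parameter $\phi_M$ as well as for the endoscopic factorizations
$\phi'$ of $\phi$. In the setting of classical groups, this follows from Corollary \ref{strong-shahidi-arthur}."
— then the heredity paragraph and the scalar (`L13396–L13405`, quoted under `LeviData.TPCM`, `LeviData.Heredity`,
`LeviData.WhittakerScalarOne`).  TYPED at `(s, M, φ_M)` with `φ = ι ∘ φ_M` (§11 `induced`): `TPCM` ∧ (TPC for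
the packets of the factor parameters `φ′ = (q₁, q₂)` of §11's `EndoData` at every `x ∈ A_φ`) ∧ `Heredity` ∧
`WhittakerScalarOne` — in the shape of the premise `suppl` of §11's `AGIKMS.ThmD21C`.
[claim: AGIKMS2024, under-review] (assumptions of Thm D.2.1, l.13392-13405, named) -/
def AGIKMS.D21Suppl (Pk : PacketAssignment Ω D) (I : LeviData Ω D) (E : EndoData Ω D) (W : WhittakerData Ω D I) :
    (s : LocalClassicalScope) → (L : I.Levi s) → I.ParamM s L → Prop :=
  fun s L φM =>
    I.TPCM W s L φM ∧
    (∀ x : (D.shape s (I.induced s L φM)).AElt,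
      (Pk (E.e₁ s (I.induced s L φM) x) (E.q₁ s (I.induced s L φM) x)).TPCAt W ∧
      (Pk (E.e₂ s (I.induced s L φM) x) (E.q₂ s (I.induced s L φM) x)).TPCAt W) ∧
    I.Heredity W s L φM ∧ I.WhittakerScalarOne W s L φM

/-- **[AGIKMS] Thm D.2.1 = `2.5.5` with its supplementary assumptions NAMED** (`note30.tex:L13407–L13413`,
VERBATIM: "\begin{thm}\label{2.5.5} Under the above assumptions, we have \[ e(s,u)=1. \] In other words, Equation
\eqref{A-LIR} in Section \ref{sec.main3} holds. \end{thm}"): §11's schematic `AGIKMS.ThmD21C I E suppl` (weak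
LIR with an unknown scalar ⟹ (A-LIR), on `L19.supplied`, tempered induced shapes) INSTANTIATED at `suppl :=
AGIKMS.D21Suppl Pk I E W` — closing GAPS G-TY-5-3 (e) ("Thm D.2.1's supplementary assumptions are one opaque
premise `suppl`").  STATUS: PREPRINT. [claim: AGIKMS2024, under-review] (Thm D.2.1 = `2.5.5`, l.13341-13413, premises named) -/
def AGIKMS.ThmD21N (Pk : PacketAssignment Ω D) (I : LeviData Ω D) (E : EndoData Ω D) (W : WhittakerData Ω D I) :
    Prop :=
  AGIKMS.ThmD21C I E (AGIKMS.D21Suppl Pk I E W)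

/-- the named form, unfolded: on `L19.supplied` (non-archimedean, quasi-split), for tempered induced shapes, the
four named assumptions and the weak LIR with an unknown scalar give (A-LIR). [folklore] (`Iff.rfl`) -/
theorem AGIKMS.thmD21N_iff (Pk : PacketAssignment Ω D) (I : LeviData Ω D) (E : EndoData Ω D)
    (W : WhittakerData Ω D I) :
    AGIKMS.ThmD21N Pk I E W ↔
      ∀ s, L19.supplied s → ∀ (L : I.Levi s) (φM : I.ParamM s L), (D.shape s (I.induced s L φM)).IsTempered →
        AGIKMS.D21Suppl Pk I E W s L φM → ∀ u : I.NEl s L φM, ALIRUpToScalar I E s L φM u → ALIR I E s L φM u :=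
  Iff.rfl

/-- the tags to which [AGIKMS] attach a CONNECTED classical group `G` in App. D's sense: `SO_{2n+1}`, `Sp_{2n}`,
`U_n` — `false` for the even-orthogonal tags (their `G = O_{2n}(F)` is disconnected, `note30.tex:L1325`: "Then
$G=G^\circ$ unless $G = \O_{2n}^\eta(F)$ in which case $G^\circ = \SO_{2n}^\eta(F)$."; the cell's packets at such
scopes follow [AGIKMS]'s `O_{2n}` convention, §11, D-TY-06/37) and for `GL` tags. [folklore] (tag reading) -/
def ClassicalType.isConnectedClassical : ClassicalType → Bool
  | .SOodd _ => true
  | .Sp _ => true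
  | .U _ => true
  | _ => false

/-- **[AGIKMS] Cor. D.1.3 = `strong-shahidi-arthur` as an edge** (`note30.tex:L13309–L13313`, VERBATIM up to its
last clause): "\begin{cor}\label{strong-shahidi-arthur} Let $G$ be a quasi-split connected classical group.
Assume that the local results \eqref{ECR1} and \eqref{ECR2} of \cite{Ar} and \cite{Mok} are known for the
parameter $\phi$ and for its factorizations through endoscopic groups." — conclusion: [Conj. D.1.1 = `TPC`]
"holds for $\Pi_\phi$." (`L13313`).  TYPED at quasi-split scopes of connected classical type
(`isConnectedClassical`; even-orthogonal tags excluded, see there), tempered shapes: (ECR1) ∧ (ECR2) for `φ` and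
for the two factor parameters at every `x ∈ A_φ` ⟹ `TPCAt` for `Π_φ`.  This is how [AGIKMS] discharge the TPC
assumptions of Thm D.2.1 for classical groups (`L13395`).  Recorded as an edge, not re-proved (the printed proof,
`L13315–L13335`, inducts on the size of the packet using Thm D.1.2).  STATUS: PREPRINT.
[claim: AGIKMS2024, under-review] (Cor. D.1.3 = `strong-shahidi-arthur`, l.13309-13314, edge shape) -/
def AGIKMS.CorD13 (Pk : PacketAssignment Ω D) (E : EndoData Ω D) (W : WhittakerData Ω D I) : Prop :=
  ∀ s : LocalClassicalScope, s.form = .quasiSplit → s.type.isConnectedClassical = true →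
    ∀ p : Ω.Param s, (D.shape s p).IsTempered →
      ((Pk s p).ECR1 p (D.indexGG0 s) ∧ ∀ x, ECR2 Pk E s p x) →
      (∀ x : (D.shape s p).AElt,
        ((Pk (E.e₁ s p x) (E.q₁ s p x)).ECR1 (E.q₁ s p x) (D.indexGG0 (E.e₁ s p x)) ∧
          ∀ x', ECR2 Pk E (E.e₁ s p x) (E.q₁ s p x) x') ∧
        ((Pk (E.e₂ s p x) (E.q₂ s p x)).ECR1 (E.q₂ s p x) (D.indexGG0 (E.e₂ s p x)) ∧
          ∀ x', ECR2 Pk E (E.e₂ s p x) (E.q₂ s p x) x')) →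
      (Pk s p).TPCAt W

end D21

/-! ## §17.3  [AGIKMS] Hypothesis 4.4.2 = `ECR`, Remark 4.4.3, and [Ar, Prop. 7.4.1] = [Mok] Prop. 8.4.1 (cell DIVERGENCE D-UP-15) -/

section HypECR

variable {Ω : World} {D : ShapeData Ω}

/-- **Duality data, UNINTERPRETED**: `hat s ψ = ψ̂` ([AGIKMS] `note30.tex:L2040–L2044`, VERBATIM: "For a
representation $\psi \colon W_E \times \SL_2(\C) \times \SL_2(\C) \rightarrow \GL_N(\C)$, we define its Aubert
dual $\widehat\psi \colon W_E \times \SL_2(\C) \times \SL_2(\C) \rightarrow \GL_N(\C)$ by \[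
\widehat\psi(w,\alpha_1,\alpha_2) = \psi(w,\alpha_2,\alpha_1). \]"); `phiOf s ψ = φ_ψ` ([Mok] `main.tex:L586–
L589`, VERBATIM: "then we define the $L$-parameter $\phi_{\psi} \in \Phi(G)$ associated to $\psi$ by the
formula: \begin{eqnarray} \phi_{\psi}(\sigma) = \psi\Big(\sigma,   \begin{pmatrix}   |\sigma|^{1/2}  &  0 \\
0  &     |\sigma|^{-1/2}     \\ \end{pmatrix}  \Big) \mbox{ for } \sigma \in L_{F}. \end{eqnarray}");
`charLift s ψ : Ŝ_{φ_ψ} → Ŝ_ψ` the map of characters dual to (`main.tex:L9105`, VERBATIM) "One has $S_{\psi}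
\subset S_{\phi_{\psi}}$ and $\mathcal{S}_{\psi}$ surjects to $\mathcal{S}_{\phi_{\psi}}$."  Nothing relates the
SHAPES of `ψ̂`, `φ_ψ` to that of `ψ` (the cell's `ParamShape` does not see the Deligne `SL_2`), and injectivity
of `charLift` is not imposed (DIVERGENCE D-TY-67). [folklore] (a first-order signature for the audit; no source asserts anything here) -/
structure DualityData (Ω : World) (D : ShapeData Ω) where
  /-- `ψ ↦ ψ̂` (Aubert dual) -/
  hat : (s : LocalClassicalScope) → Ω.Param s → Ω.Param s
  /-- `ψ ↦ φ_ψ` -/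
  phiOf : (s : LocalClassicalScope) → Ω.Param s → Ω.Param s
  /-- `Ŝ_{φ_ψ} ↪ Ŝ_ψ` -/
  charLift : (s : LocalClassicalScope) → (p : Ω.Param s) → (D.shape s (phiOf s p)).AChar → (D.shape s p).AChar

/-- **`G_0` of a proper Levi `M` of `G`, on the tags** — [AGIKMS] `note30.tex:L2054–L2056`, VERBATIM: "Fix a
standard parabolic subgroup $P = MN_P$ of $G$ such that $M \cong \GL_{k_t}(E) \times \dots \times \GL_{k_1}(E)
\times G_0$, where $G_0$ is a classical group of the same type as $G$."  `t₀.leviFactorOf t` = "`t₀` is the type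
of the classical factor `G_0` of a PROPER Levi subgroup of the quasi-split group of type `t`": same family,
smaller rank (`n_0 = n - Σ k_i`; for `U_n`, `n_0 = n - 2Σ k_i`, same parity; for `SO_{2n}^η` the same `η`; for
`GL_N`, a smaller `GL`).  The `GL_{k_i}(E)` factors of `M` are not recorded (their packets are singletons; D-TY-67).
[folklore] (standard shape of the Levi subgroups of classical groups, as a tag relation) -/
def ClassicalType.leviFactorOf : ClassicalType → ClassicalType → Bool
  | .SOodd n₀, .SOodd n => Nat.blt n₀ n
  | .Sp n₀, .Sp n => Nat.blt n₀ n
  | .SOeven n₀ η₀, .SOeven n η => Nat.blt n₀ n && η₀ == η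
  | .U n₀, .U n => Nat.blt n₀ n && n₀ % 2 == n % 2
  | .GL N₀ q₀, .GL N q => Nat.blt N₀ N && q₀ == q
  | _, _ => false

/-- `G_0` of a proper Levi has strictly smaller `dim St` — so Hypothesis `ECR`'s Levi clause sits inside
`hyp.arthur`'s second bullet. [folklore] (case analysis, proved) -/
theorem ClassicalType.stdDim_lt_of_leviFactorOf {t₀ t : ClassicalType} (h : t₀.leviFactorOf t = true) :
    t₀.stdDim < t.stdDim := by
  cases t₀ <;> cases t <;> simp_all [ClassicalType.leviFactorOf, ClassicalType.stdDim]

variable (Pk : PacketAssignment Ω D) (I : LeviData Ω D) (E : EndoData Ω D) (Φ : DualityData Ω D)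

/-- **[AGIKMS] Hypothesis 4.4.2 = `\label{ECR}`** (`note30.tex:L6416–L6424`, VERBATIM): "\begin{hyp}\label{ECR}
Fix an $A$-parameter $\psi$ for $G$. Then there exist multi-sets $\Pi_{\psi}$ and $\Pi_{\widehat\psi}$ over
$\Irr(G)$ equipped with $\pair{\cdot,\pi}_{\psi}$ and $\pair{\cdot,\pi'}_{\widehat\psi}$ satisfying \eqref{ECR1}
and \eqref{ECR2} in Section \ref{sec.Arthur}. Moreover, we assume that for any proper Levi subgroup $M$ of $G$
and any $A$-parameter $\psi_M$ for $M$, there exists a multi-set $\Pi_{\psi_M}$ over $\Irr(M)$ equipped with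
$\pair{\cdot,\pi_M}_{\psi_M}$ satisfying \eqref{ECR1} and \eqref{ECR2} in Section \ref{sec.Arthur}. \end{hyp}"
Remark 4.4.3 (`L6427–L6432`): "Notice that Hypothesis \ref{ECR} does not require members in $A$-packets to be
unitary. For a proper Levi subgroup $M$, Hypothesis \ref{ECR} assumes Arthur's results for all $A$-parameters
$\psi_M$, whereas, for $G$, it assumes only for a fixed $A$-parameter $\psi$ and its dual $\widehat\psi$."
TYPED at `(s, ψ)` for the packets of an assignment `Π`: (ECR1) ∧ (ECR2) for `ψ`; for `ψ̂ = Φ.hat s ψ`; and for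
EVERY parameter at every scope of the same field kind and form whose type is the `G_0` of a proper Levi of `G`
(`ClassicalType.leviFactorOf` — the Levi clause read on the classical factor, D-TY-67).
[claim: AGIKMS2024, under-review] (Hypothesis 4.4.2 = `ECR`, l.6416-6424, with Remark 4.4.3 l.6427-6432) -/
def AGIKMS.HypECRC (s : LocalClassicalScope) (p : Ω.Param s) : Prop :=
  ((Pk s p).ECR1 p (D.indexGG0 s) ∧ ∀ x, ECR2 Pk E s p x) ∧
  ((Pk s (Φ.hat s p)).ECR1 (Φ.hat s p) (D.indexGG0 s) ∧ ∀ x, ECR2 Pk E s (Φ.hat s p) x) ∧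
  (∀ s' : LocalClassicalScope, s'.field = s.field → s'.form = s.form → s'.type.leviFactorOf s.type = true →
    ∀ p' : Ω.Param s', (Pk s' p').ECR1 p' (D.indexGG0 s') ∧ ∀ x, ECR2 Pk E s' p' x)

/-- **Remark 4.4.3, last sentence, kernel-checked** (`note30.tex:L6433–L6435`, VERBATIM): "In particular, if $\psi
= \phi$ is a tempered $L$-parameter for $G$, after establishing \eqref{ECR1} and \eqref{ECR2} for $\widehat\phi$
in the next section, one can use results in this section for $\phi$ and $\widehat\phi$.": `hyp.arthur` at `s`
(§11 `HypArthurC`: clause 1 gives (ECR1), (ECR2) for the tempered `φ`, clause 3 covers every `G_0` of a proper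
Levi by `stdDim_lt_of_leviFactorOf`) together with (ECR1), (ECR2) for `φ̂` yields Hypothesis `ECR` at `(s, φ)`.
[folklore] (kernel-checked consequence of the typed hypotheses) -/
theorem HypArthurC.hypECR {Pk : PacketAssignment Ω D} {I : LeviData Ω D} {E : EndoData Ω D}
    {s : LocalClassicalScope} (hH : HypArthurC Pk I E s) (Φ : DualityData Ω D) (p : Ω.Param s)
    (hp : (D.shape s p).IsTempered)
    (hhat : (Pk s (Φ.hat s p)).ECR1 (Φ.hat s p) (D.indexGG0 s) ∧ ∀ x, ECR2 Pk E s (Φ.hat s p) x) :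
    AGIKMS.HypECRC Pk E Φ s p :=
  ⟨hH.1 p hp, hhat, fun s' hf hfo hl p' =>
    (hH.2.2 s' hf hfo (ClassicalType.stdDim_lt_of_leviFactorOf hl)).1 p'⟩

/-- **[Mok] Prop. 8.4.1 = [Ar, Prop. 7.4.1]** (`main.tex:L9107–L9112`, VERBATIM): "\begin{proposition}
(Proposition 7.4.1 of \cite{A1}) Suppose that theorem 3.2.1 holds for a parameter $\psi \in \Psi(G)$. Then the
elements of $\Pi_{\phi_{\psi}}$ belong to $\Pi_{\psi}$ (in particular are unitary representations) and they occur
with multiplicity one in the packet $\Pi_{\psi}$, such that the following diagram commutes: \begin{eqnarray*}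
\xymatrix{ \Pi_{\phi_{\psi}} \ar@{^{(}->}[r] \ar@{^{(}->}[d]  & \Pi_{\psi}  \ar[d] \\
\widehat{\mathcal{S}}_{\phi_{\psi}} \ar@{^{(}->}[r] & \widehat{\mathcal{S}}_{\psi} } \end{eqnarray*}
\end{proposition}" (context `L9105`: "for a general parameter $\psi \in \Psi(G)$, recall the generic parameter
$\phi_{\psi} \in \Phi(G)$ associated to $\psi$. […] The packet $\Pi_{\phi_{\psi}}$ of irreducible representations
associated to the generic parameter $\phi_{\psi}$ is constructed from Langlands quotient of the packet of
standard representations associated to $\phi_{\psi}$").  TYPED at `(s, ψ)` over `DualityData`: IF (ECR1) and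
(ECR2) hold for `Π_ψ` ([Mok] Thm 3.2.1 = the Book's Thm 2.2.1 for `ψ`, §11), THEN every member of `Π_{φ_ψ}`
occurs exactly once in `Π_ψ` and its character in `Π_ψ` is the lift of its character in `Π_{φ_ψ}`.  Unitarity
is not typed.  The Book's own wording is NOT HELD (acq-04129); this is [Mok]'s unitary statement, whose first
line attributes it to [Ar, Prop. 7.4.1].  In both memoirs the proposition is proved inside the long induction
(global methods): it is part of "Arthur's results" for the group in question, not of (ECR1)/(ECR2)/(A-LIR).
[cite: Mok2012, Prop. 8.4.1 (arXiv l.9107-9112; = Arthur2013 Prop. 7.4.1 by Mok's attribution)] -/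
def Book.P741 (s : LocalClassicalScope) (p : Ω.Param s) : Prop :=
  ((Pk s p).ECR1 p (D.indexGG0 s) ∧ ∀ x, ECR2 Pk E s p x) →
    ∀ π, π ∈ (Pk s (Φ.phiOf s p)).members →
      (∃! i : Fin (Pk s p).members.length, (Pk s p).members.get i = π) ∧
      (Pk s p).pairing π = Φ.charLift s p ((Pk s (Φ.phiOf s p)).pairing π)

/-- **`hyp.arthur` STRENGTHENED by what the proof of [AGIKMS] Prop. 4.5.1 = `c-irred` invokes** (cell DIVERGENCE
D-UP-15).  Prop. 4.5.1 (`note30.tex:L6770–L6773`, VERBATIM): "\begin{prop}\label{c-irred} Assume Hypothesis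
\ref{ECR}. If $\psi$ is irreducible and conjugate-self-dual, then $\beta(\psi) = (-1)^{r(\psi)}$. \end{prop}"; its
proof, `L6782–L6785`: "By \cite[Proposition 7.4.1]{Ar} and \cite[Proposition 8.4.1]{Mok} which we can use because
we are assuming Hypothesis \ref{ECR}, we can take $\pi$ to be an element in the associated $L$-packet
$\Pi_{\phi_\psi}$. If $\pi$ is the unique element in this $L$-packet corresponding to the trivial character of
$\AA_{\phi_\psi}$,".  Prop. 4.5.1 feeds Thm 1.10.5 = `main3` (2) for the smaller groups `G′` (§11 `AGIKMS.Main3C`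
is stated from `HypArthurC`, the PRINTED Hypothesis 1.10.4: (ECR1), (ECR2), (A-LIR) on the smaller groups).  The
strengthened hypothesis adds [Ar, Prop. 7.4.1] (`Book.P741`) for every parameter at every scope of the same field
kind and form with smaller `dim St` — "Arthur's results" for `G′` in the words of Remark 4.4.3.  `printed`
projects it onto §11's `HypArthurC`; NO status word of the DAG changes (both readings live inside `IH N` of module
`DependencyDag`).  [claim: AGIKMS2024, under-review] (Hypothesis 1.10.4 l.2327-2338 as USED at l.6782-6785; the cell's typed distinction D-UP-15) -/
def HypArthurCPlus (s : LocalClassicalScope) : Prop :=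
  HypArthurC Pk I E s ∧
  ∀ s' : LocalClassicalScope, s'.field = s.field → s'.form = s.form → s'.type.stdDim < s.type.stdDim →
    ∀ p' : Ω.Param s', Book.P741 Pk E Φ s' p'

/-- the strengthened hypothesis projects onto the printed one (§11 `HypArthurC`). [folklore] (projection) -/
theorem HypArthurCPlus.printed {Pk : PacketAssignment Ω D} {I : LeviData Ω D} {E : EndoData Ω D}
    {Φ : DualityData Ω D} {s : LocalClassicalScope} (h : HypArthurCPlus Pk I E Φ s) : HypArthurC Pk I E s :=
  h.1

/-- under the strengthened hypothesis, at every smaller `G′` of the same field kind and form and every `ψ′`: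
`Π_{φ_ψ′} ⊂ Π_{ψ′}` with multiplicity one and compatible characters — Prop. 7.4.1's hypothesis being discharged
by clause 3 of the printed `hyp.arthur`; this is the form used at `L6784` ("we can take $\pi$ to be an element
in the associated $L$-packet $\Pi_{\phi_\psi}$"). [folklore] (kernel-checked modus ponens over the typed hypotheses) -/
theorem HypArthurCPlus.phiPsi_sub {Pk : PacketAssignment Ω D} {I : LeviData Ω D} {E : EndoData Ω D}
    {Φ : DualityData Ω D} {s : LocalClassicalScope} (h : HypArthurCPlus Pk I E Φ s) (s' : LocalClassicalScope)
    (hf : s'.field = s.field) (hfo : s'.form = s.form) (hlt : s'.type.stdDim < s.type.stdDim) (p' : Ω.Param s') :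
    ∀ π, π ∈ (Pk s' (Φ.phiOf s' p')).members →
      (∃! i : Fin (Pk s' p').members.length, (Pk s' p').members.get i = π) ∧
      (Pk s' p').pairing π = Φ.charLift s' p' ((Pk s' (Φ.phiOf s' p')).pairing π) :=
  h.2 s' hf hfo hlt p' ((h.1.2.2 s' hf hfo hlt).1 p')

/-- **Where the three typed hypotheses sit (kernel-checked on the tags):** the `G_0 = Sp_2` of the Siegel-type
Levi `GL_2 × Sp_2` of `Sp_6` is a Levi factor and has smaller `dim St` (3 < 7), so it is covered by both
Hypothesis `ECR`'s Levi clause and `hyp.arthur`'s second bullet; the endoscopic factor `O_4^{η′}` of `Sp_6` is NOT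
a Levi factor of `Sp_6` (other family) but IS below it in `dim St` (4 < 7) — `hyp.arthur` covers endoscopic
groups, Hypothesis `ECR` (as printed) only Levi subgroups; `U_4` is not the `G_0` of a proper Levi of `U_5` (parity).
[folklore] (`decide`) -/
theorem leviFactor_vs_endoFactor_examples :
    (ClassicalType.Sp 1).leviFactorOf (.Sp 3) = true ∧ (ClassicalType.Sp 1).stdDim < (ClassicalType.Sp 3).stdDim ∧
    (ClassicalType.SOeven 2 false).leviFactorOf (.Sp 3) = false ∧
    (ClassicalType.SOeven 2 false).stdDim < (ClassicalType.Sp 3).stdDim ∧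
    (ClassicalType.Sp 3).endoFactor 4 (.SOeven 2 false) = true ∧
    (ClassicalType.U 4).leviFactorOf (.U 5) = false ∧ (ClassicalType.U 3).leviFactorOf (.U 5) = true := by
  decide

end HypECR

end Literature.NumberTheory.Automorphic.Arthur2013.Leaves
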